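import Summits.ResolutionOfSingularities.ResolutionOfSingularities.Theorems.HilbertSamuelEliminationSigmaMaxModificationsCorridor3WLadderMovingIsoDefs
import Summits.ResolutionOfSingularities.ResolutionOfSingularities.Theorems.HilbertSamuelEliminationSigmaMaxModificationsCorridor3WLadderMoving
import HarnessLib

/-!
# [OURS · L1 W4.2] MODULE `Corridor3WLadderMovingIso` (crux chain w42, idea-2 ROUND 4 card G `iso-recurrence-core`) — part 2/2:
# the PROVED reductions (covers A/B of the core, the tower reduction, oracle-class rows and the restart reduction)

PROVENANCE / SPLIT FOR THE GATE (typer res-type-012, res-L1-w42-plan-1 RULING «CHAIN w42 v3.8a ADDENDUM» (a-5) 2026-08-27T05:15:33Z):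
see part 1/2 `…Corridor3WLadderMovingIsoDefs` (every DEFINITION). This part carries every `theorem` of res-L1-w42-idea-2's (gen 4)
`HOME/L/res-L1-w42-idea-2/Sketch-L1-idea-2-r4.lean` (sha16 `323675defc0b214f`) BYTE-IDENTICAL and in the SAME namespace
`…Cruxes.SigmaMaxModifications.IdeasL1Idea2R4`, EXCEPT the sketch's §1 local copies `io_shift`, `eventually_not_or_io`, `moving_split_iff`,
which restate (identical statements and proofs) the LANDED `…Theorems.SigmaMaxModificationsCorridor3.Moving.io_shift` /
`.eventually_not_or_io` / `.noMovingNearChainFrom_iff_recurrence` of `…Corridor3WLadderMoving` (res-type-053) and are therefore CITED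
INSTEAD of re-declared (this module imports `…Corridor3WLadderMoving`; the six call sites of `moving_split_iff` read
`noMovingNearChainFrom_iff_recurrence`, the two call sites of `io_shift` resolve to the landed lemma through the sketch's own
`open …Moving`); plus `set_option linter.dupNamespace false`. The two §1 monotonicity lemmas are new and stay. Every theorem is
sorry-free over the standard axioms; the open content of the card sits in the `def … : Prop` rows of part 1/2, which enter here only as
hypotheses BY NAME. OURS; NOT statements of [CossartJannsenSaito2020] nor of [Hironaka2017]; AI typing, weaker than expert review.
idea-2's module docstring follows unchanged.
-/

/-!
# [OURS · L1 W4.2] Sketch-L1-idea-2 — ROUND 4 (gen 4): THE CORE `stub_Wtop3M_nonpointed` — second layer by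
# RECURRENCE OF ISOLATION (moving), the ORACLE-FREE local form of its isolated half, and ORACLE LOCALITY

OURS (cell res-hironaka, slot W4.2, crux chain w42, IDEATOR res-L1-w42-idea-2 gen 4, technique B = modification-form gluing +
HS-strata noetherian induction); NOT statements of the manuscript [Hironaka2017] nor of [CossartJannsenSaito2020]; AI ideation,
weaker than expert review. Every `theorem` below is PROVED (no `sorry`); the open content sits in `def … : Prop` rows.
Written against the LANDED definitions module `…Corridor3WLadderMovingDefs` (p-id per res-type-053, 2026-08-27T04:24Z; namespace
`…Theorems.SigmaMaxModificationsCorridor3.Moving`): `MaxOriginNoMovingNearChainAtQ`, `MaxOriginNoMovingRecurrentNearChainAtQ`,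
`Iso`, `Wtop3PointedM`, `Wtop3NonpointedM` are used BY NAME, so every join below concludes the REGISTERED row constants of
skeleton `w_ladder` v5 (`stub_Wtop3M_pointed`, `stub_Wtop3M_nonpointed`).

## What this file types (card G `idea-iso-recurrence-core.md`)

§1  the moving recurrence split (re-proved locally as `moving_split_iff`; identical to the module's
    `noMovingNearChainFrom_iff_recurrence`, whose proof part has not landed at the time of writing).
§2  THE 2 × 2 OF THE CORE.  For any origin predicate `Q`, four rows at grade `3 ≤ ē`:
      `WtopEvIsoM p Q`     — no moving E3 chain that is (from a reachable stage on) ISOLATED at every stage;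
      `WtopRecNonIsoM p Q` — no moving E3 chain that is NON-isolated infinitely often;
      `WtopRecIsoM p Q`    — no moving E3 chain that is ISOLATED infinitely often;
      `WtopEvNonIsoM p Q`  — no moving E3 chain that is (from a reachable stage on) NEVER isolated;
    and the two PROVED covers  `EvIso ∧ RecNonIso ⇒ row`  (cover A)  and  `RecIso ∧ EvNonIso ⇒ row`  (cover B), specialised
    to BOTH registered W-top stubs (`wtop3NonpointedM_of_coverA/B`, `wtop3PointedM_of_coverA/B`): pointedness of the ORIGIN
    is not what the dynamics sees — recurrence of isolation ALONG THE CHAIN is (it is tail-stable; `QPointed` is not).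
§3  THE ORACLE EVAPORATES ON AN ISOLATED TAIL.  `IsIsoPointTower` / `IsoQuadraticTowerTerminates p N`: the label-free,
    oracle-free, history-free LOCAL statement «no infinite tower of blow-ups AT THE MARKED CLOSED POINTS, each near the
    previous one, each isolated in the Hilbert–Samuel locus of its stage, of grade `ē ≥ 3`, over a maximal origin» (typed
    over the Literature carrier `BlowupTower`, centres `C n = {pt n}`), the extraction row `IsoTailTowerExtractionM p`
    (M: at an isolated stage the only centre through the marked point is the point; waiting steps and far components are
    pruned by open restriction — blow-ups are local on the base), and the PROVED reduction
    `wtopEvIsoM_of_towers : IsoQuadraticTowerTerminates p 3 → IsoTailTowerExtractionM p → ∀ Q, WtopEvIsoM p Q`.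
§4  ORACLE LOCALITY.  The rows quantify over ALL functional admissible oracles (the calibration instantiates a CHOICE
    oracle, `exists_choiceOracle`); every restart / localisation / generic-point argument needs oracles compatible with
    Zariski localisation — which CJS's canonical sequences ARE in print (Thm. 1.1 «compatible with … (Zariski or étale)
    localizations», Ch. 17).  Rows relative to an oracle CLASS `𝓞` (`…AtQO 𝓞`, weaker than the registered rows:
    `atQO_of_atQ`), the restart row `IsoOpenRestartM 𝓞 p` (at a reachable ISOLATED stage the marked chain continues as a
    marked chain of the run from the POINTED maximal origin `(U, x_s)`, `U(ν) = {x_s}`), and the PROVED reductions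
    `wtopRecIsoMO_of_restart : IsoOpenRestartM 𝓞 p → WtopRecIsoMO 𝓞 p QPointed → ∀ Q, WtopRecIsoMO 𝓞 p Q` and cover B in
    class form `rowO_of_coverB`.  With `𝓞 = ⊤` these are the registered rows (`wtop3NonpointedM_of_coverB_restart`).
-/

set_option linter.dupNamespace false

open CategoryTheory AlgebraicGeometry TopologicalSpace
open Summit.ResolutionOfSingularities.ResolutionOfSingularities.Theorems.CampaignW42
open Literature.AlgebraicGeometry.Resolution Literature.RingTheory.HilbertSamuel
open Literature.AlgebraicGeometry.CossartJannsenSaito2020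
open Summit.ResolutionOfSingularities.ResolutionOfSingularities.Theses.HilbertSamuelElimination
open Summit.ResolutionOfSingularities.ResolutionOfSingularities.Theorems.SigmaMaxModificationsCorridor3
open Summit.ResolutionOfSingularities.ResolutionOfSingularities.Theorems.SigmaMaxModificationsCorridor3.Moving
open Summit.ResolutionOfSingularities.ResolutionOfSingularities.Theorems.SigmaMaxModificationsCorridor3.Helpers (QPointed)

namespace Summit.ResolutionOfSingularities.ResolutionOfSingularities.Cruxes.SigmaMaxModifications.IdeasL1Idea2R4

universe u

variable {R : ∀ S : Scheme.{u}, CentreSeq S → Prop} {N : ℕ} {ν : ℕ → ℕ}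

/-! ## §1. The moving recurrence split — CITED from `…Corridor3WLadderMoving` (`io_shift`, `eventually_not_or_io`,
`noMovingNearChainFrom_iff_recurrence`); the two monotonicity lemmas of the sketch follow. -/

/-- Monotonicity of the moving row functional in the grade. [folklore] -/
theorem noMovingNearChainFrom_mono {s₀ : MarkedStage.{u}} {G G' : MarkedStage.{u} → Prop} (hGG' : ∀ s, G s → G' s)
    (h : NoMovingNearChainFrom R N ν s₀ G') : NoMovingNearChainFrom R N ν s₀ G :=
  fun ⟨c, h0, hstep, hG, hmov⟩ => h ⟨c, h0, hstep, fun n => hGG' _ (hG n), hmov⟩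

/-- Monotonicity of the moving-recurrent functional in the recurring predicate. [folklore] -/
theorem noMovingRecurrentNearChainFrom_mono {s₀ : MarkedStage.{u}} {G B B' : MarkedStage.{u} → Prop}
    (hBB' : ∀ s, B s → B' s) (h : NoMovingRecurrentNearChainFrom R N ν s₀ G B') :
    NoMovingRecurrentNearChainFrom R N ν s₀ G B :=
  fun ⟨c, h0, hstep, hG, hmov, hio⟩ =>
    h ⟨c, h0, hstep, hG, hmov, fun n => (hio n).imp fun _ hm => ⟨hm.1, hBB' _ hm.2⟩⟩

/-! ## §2. The 2 × 2 of the core: recurrence of ISOLATION along the chain, for any origin predicate `Q` -/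

/-- **Cover A (proved):** Ev-Iso ∧ Rec-NonIso ⇒ the grade-`≥ 3` moving row at `Q`-origins. [folklore] -/
theorem atQ_of_coverA {p : ℕ} {Q : ℕ → (ℕ → ℕ) → ∀ X : Scheme.{u}, X → Prop}
    (hev : WtopEvIsoM p Q) (hrec : WtopRecNonIsoM p Q) :
    MaxOriginNoMovingNearChainAtQ.{u} p 3 Q fun s => 3 ≤ s.geomDirDim := by
  intro R hRf hRa ν X _ x hX hQ
  refine (noMovingNearChainFrom_iff_recurrence (fun s => ¬ Iso 3 s)).2 ⟨?_, hrec R hRf hRa ν X x hX hQ⟩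
  exact noMovingNearChainFrom_mono (fun s hs => ⟨hs.1, Classical.not_not.1 hs.2⟩) (hev R hRf hRa ν X x hX hQ)

/-- **Cover B (proved):** Rec-Iso ∧ Ev-NonIso ⇒ the grade-`≥ 3` moving row at `Q`-origins. [folklore] -/
theorem atQ_of_coverB {p : ℕ} {Q : ℕ → (ℕ → ℕ) → ∀ X : Scheme.{u}, X → Prop}
    (hrec : WtopRecIsoM p Q) (hev : WtopEvNonIsoM p Q) :
    MaxOriginNoMovingNearChainAtQ.{u} p 3 Q fun s => 3 ≤ s.geomDirDim :=
  fun R hRf hRa ν X _ x hX hQ => (noMovingNearChainFrom_iff_recurrence (fun s => Iso 3 s)).2 ⟨hev R hRf hRa ν X x hX hQ, hrec R hRf hRa ν X x hX hQ⟩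

/-- **Both covers are exact (proved):** the row gives back each of the four pieces. [folklore] -/
theorem pieces_of_atQ {p : ℕ} {Q : ℕ → (ℕ → ℕ) → ∀ X : Scheme.{u}, X → Prop}
    (h : MaxOriginNoMovingNearChainAtQ.{u} p 3 Q fun s => 3 ≤ s.geomDirDim) :
    WtopEvIsoM p Q ∧ WtopRecNonIsoM p Q ∧ WtopRecIsoM p Q ∧ WtopEvNonIsoM p Q := by
  refine ⟨fun R hRf hRa ν X _ x hX hQ => ?_, fun R hRf hRa ν X _ x hX hQ => ?_,
    fun R hRf hRa ν X _ x hX hQ => ?_, fun R hRf hRa ν X _ x hX hQ => ?_⟩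
  · exact noMovingNearChainFrom_mono (fun s hs => hs.1) (h R hRf hRa ν X x hX hQ)
  · exact ((noMovingNearChainFrom_iff_recurrence (fun s => ¬ Iso 3 s)).1 (h R hRf hRa ν X x hX hQ)).2
  · exact ((noMovingNearChainFrom_iff_recurrence (fun s => Iso 3 s)).1 (h R hRf hRa ν X x hX hQ)).2
  · exact ((noMovingNearChainFrom_iff_recurrence (fun s => Iso 3 s)).1 (h R hRf hRa ν X x hX hQ)).1

/-- **THE CORE, cover A:** `stub_Wtop3M_nonpointed` from Ev-Iso and Rec-NonIso at non-pointed origins. [folklore] -/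
theorem wtop3NonpointedM_of_coverA {p : ℕ} (hev : WtopEvIsoM.{u} p QNonpointed) (hrec : WtopRecNonIsoM.{u} p QNonpointed) :
    Wtop3NonpointedM.{u} p :=
  atQ_of_coverA hev hrec

/-- **THE CORE, cover B:** `stub_Wtop3M_nonpointed` from Rec-Iso and Ev-NonIso at non-pointed origins. [folklore] -/
theorem wtop3NonpointedM_of_coverB {p : ℕ} (hrec : WtopRecIsoM.{u} p QNonpointed) (hev : WtopEvNonIsoM.{u} p QNonpointed) :
    Wtop3NonpointedM.{u} p :=
  atQ_of_coverB hrec hev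

/-- **The pointed stub, cover A.** [folklore] -/
theorem wtop3PointedM_of_coverA {p : ℕ} (hev : WtopEvIsoM.{u} p QPointed) (hrec : WtopRecNonIsoM.{u} p QPointed) :
    Wtop3PointedM.{u} p :=
  atQ_of_coverA hev hrec

/-- **The pointed stub, cover B.** [folklore] -/
theorem wtop3PointedM_of_coverB {p : ℕ} (hrec : WtopRecIsoM.{u} p QPointed) (hev : WtopEvNonIsoM.{u} p QPointed) :
    Wtop3PointedM.{u} p :=
  atQ_of_coverB hrec hev

/-- Rows at all origins restrict to any `Q`. [folklore] -/
theorem atQ_of_qAll {p N : ℕ} {G : MarkedStage.{u} → Prop} {Q : ℕ → (ℕ → ℕ) → ∀ X : Scheme.{u}, X → Prop}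
    (h : MaxOriginNoMovingNearChainAtQ.{u} p N QAll G) : MaxOriginNoMovingNearChainAtQ.{u} p N Q G :=
  fun R hRf hRa ν X _ x hX _ => h R hRf hRa ν X x hX trivial

/-- **Both registered W-top stubs from THREE pieces (cover B, proved):** Rec-Iso at pointed origins, Rec-Iso at non-pointed
origins, and Ev-NonIso at all origins.  (§4 merges the first two under oracle locality.) [folklore] -/
theorem wtop3M_pair_of_coverB {p : ℕ} (hrecP : WtopRecIsoM.{u} p QPointed) (hrecN : WtopRecIsoM.{u} p QNonpointed)
    (hev : WtopEvNonIsoM.{u} p QAll) : Wtop3PointedM.{u} p ∧ Wtop3NonpointedM.{u} p :=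
  ⟨wtop3PointedM_of_coverB hrecP (atQ_of_qAll hev), wtop3NonpointedM_of_coverB hrecN (atQ_of_qAll hev)⟩

/-! ## §3. The oracle evaporates on an isolated tail: point-blow-up towers at isolated near points (label-free, LOCAL) -/

/-- **The eventually-isolated half of BOTH W-top rows from the local statement (proved reduction).** [folklore] -/
theorem wtopEvIsoM_of_towers {p : ℕ} (hT : IsoQuadraticTowerTerminates.{u} p 3) (hE : IsoTailTowerExtractionM.{u} p)
    (Q : ℕ → (ℕ → ℕ) → ∀ X : Scheme.{u}, X → Prop) : WtopEvIsoM.{u} p Q := by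
  intro R hRf hRa ν X _ x hX hQ
  rintro ⟨c, h0, hstep, hG, hmov⟩
  obtain ⟨T, pt, hT0, htower⟩ := hE R hRf hRa ν X x hX c h0 hstep hG hmov
  exact hT ν T pt hT0 htower

/-- **Cover A with the local statement (proved):** the core from isolated quadratic towers, the extraction, and Rec-NonIso.
[folklore] -/
theorem wtop3NonpointedM_of_towers_recNonIso {p : ℕ} (hT : IsoQuadraticTowerTerminates.{u} p 3)
    (hE : IsoTailTowerExtractionM.{u} p) (hrec : WtopRecNonIsoM.{u} p QNonpointed) : Wtop3NonpointedM.{u} p :=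
  wtop3NonpointedM_of_coverA (wtopEvIsoM_of_towers hT hE _) hrec

/-- The same for the pointed stub. [folklore] -/
theorem wtop3PointedM_of_towers_recNonIso {p : ℕ} (hT : IsoQuadraticTowerTerminates.{u} p 3)
    (hE : IsoTailTowerExtractionM.{u} p) (hrec : WtopRecNonIsoM.{u} p QPointed) : Wtop3PointedM.{u} p :=
  wtop3PointedM_of_coverA (wtopEvIsoM_of_towers hT hE _) hrec

/-! ### §3b. The FINITE-PREFIX content of the extraction (tri-1 R3-B/R3-F′: only finite statements are specimen-testable) -/

/-! ## §4. Oracle locality: rows relative to an oracle class, and the restart at isolated stages -/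

/-- Class rows are WEAKER than the registered (all-oracle) rows. [folklore] -/
theorem atQO_of_atQ {𝓞 : (∀ S : Scheme.{u}, CentreSeq S → Prop) → Prop} {p N : ℕ}
    {Q : ℕ → (ℕ → ℕ) → ∀ X : Scheme.{u}, X → Prop} {G : MarkedStage.{u} → Prop}
    (h : MaxOriginNoMovingNearChainAtQ.{u} p N Q G) : MaxOriginNoMovingNearChainAtQO 𝓞 p N Q G :=
  fun R hRf hRa _ ν X _ x hX hQ => h R hRf hRa ν X x hX hQ

/-- … and equal to them for the trivial class. [folklore] -/
theorem atQ_of_atQO_top {p N : ℕ} {Q : ℕ → (ℕ → ℕ) → ∀ X : Scheme.{u}, X → Prop} {G : MarkedStage.{u} → Prop}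
    (h : MaxOriginNoMovingNearChainAtQO (fun _ => True) p N Q G) : MaxOriginNoMovingNearChainAtQ.{u} p N Q G :=
  fun R hRf hRa ν X _ x hX hQ => h R hRf hRa trivial ν X x hX hQ

/-- **Rec-Iso at ANY origin from Rec-Iso at POINTED origins, given the restart (proved).** [folklore] -/
theorem wtopRecIsoMO_of_restart {𝓞 : (∀ S : Scheme.{u}, CentreSeq S → Prop) → Prop} {p : ℕ}
    (hR : IsoOpenRestartM 𝓞 p) (hP : WtopRecIsoMO 𝓞 p QPointed)
    (Q : ℕ → (ℕ → ℕ) → ∀ X : Scheme.{u}, X → Prop) : WtopRecIsoMO 𝓞 p Q := by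
  intro R hRf hRa hO ν X _ x hX _
  rintro ⟨c, h0, hstep, hG, hmov, hio⟩
  -- the first isolated stage of the chain
  obtain ⟨n₀, -, hiso₀⟩ := hio 0
  have h0' : Reaches R 3 ν (MarkedStage.init X x) (c (n₀ + 0)) := reaches_chain h0 hstep n₀
  obtain ⟨U, hU, y, c', hUy, hQ, h0U, hstep', hG', hmov', hio'⟩ :=
    hR R hRf hRa hO ν X x hX (fun n => c (n₀ + n)) h0' (fun n => hstep (n₀ + n)) (fun n => hG (n₀ + n))
      (io_shift hmov n₀) (by simpa using hiso₀) (io_shift hio n₀)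
  exact @hP R hRf hRa hO ν U hU y hUy hQ ⟨c', h0U, hstep', hG', hmov', hio'⟩

/-- **Cover B in class form (proved):** the grade-`≥ 3` moving row at `Q`-origins, for oracles of class `𝓞`, from the restart,
Rec-Iso at POINTED origins and Ev-NonIso at `Q`-origins. [folklore] -/
theorem rowO_of_coverB {𝓞 : (∀ S : Scheme.{u}, CentreSeq S → Prop) → Prop} {p : ℕ}
    (hR : IsoOpenRestartM 𝓞 p) (hP : WtopRecIsoMO 𝓞 p QPointed)
    {Q : ℕ → (ℕ → ℕ) → ∀ X : Scheme.{u}, X → Prop} (hev : WtopEvNonIsoMO 𝓞 p Q) :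
    MaxOriginNoMovingNearChainAtQO 𝓞 p 3 Q fun s => 3 ≤ s.geomDirDim :=
  fun R hRf hRa hO ν X _ x hX hQ =>
    (noMovingNearChainFrom_iff_recurrence (fun s => Iso 3 s)).2
      ⟨hev R hRf hRa hO ν X x hX hQ, wtopRecIsoMO_of_restart hR hP Q R hRf hRa hO ν X x hX hQ⟩

/-- **THE CORE from the pointed units-half, the companion half and the restart — trivial class, i.e. the REGISTERED row
(proved; the restart hypothesis is then the risky one, see `IsoOpenRestartM`).** [folklore] -/
theorem wtop3NonpointedM_of_coverB_restart {p : ℕ} (hR : IsoOpenRestartM.{u} (fun _ => True) p)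
    (hP : WtopRecIsoM.{u} p QPointed) (hev : WtopEvNonIsoM.{u} p QNonpointed) : Wtop3NonpointedM.{u} p := by
  have hP' : WtopRecIsoMO.{u} (fun _ => True) p QPointed :=
    fun R hRf hRa _ ν X _ x hX hQ => hP R hRf hRa ν X x hX hQ
  have hev' : WtopEvNonIsoMO.{u} (fun _ => True) p QNonpointed :=
    fun R hRf hRa _ ν X _ x hX hQ => hev R hRf hRa ν X x hX hQ
  exact atQ_of_atQO_top (rowO_of_coverB hR hP' hev')

/-- Rec-Iso at pointed origins is WEAKER than the registered pointed stub (proved). [folklore] -/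
theorem wtopRecIsoM_pointed_of_wtop3PointedM {p : ℕ} (h : Wtop3PointedM.{u} p) : WtopRecIsoM.{u} p QPointed :=
  (pieces_of_atQ h).2.2.1

end Summit.ResolutionOfSingularities.ResolutionOfSingularities.Cruxes.SigmaMaxModifications.IdeasL1Idea2R4
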